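import Mathlib
import HarnessLib
import Summits.NavierStokesRegularity.NavierStokesRegularity.Theorems.UnthreadedRigidityDoorUnthreadedRigidityVirialHornTwoChannelCoeff

/-!
# Route `UnthreadedRigidityDoor`, item `UnthreadedRigidity` (W2, stmt-NavierStokesRegularity-27585) — LINE g11-1 «VIRIAL HORN»,
# BRIDGE V for PLATEAU PROFILES («TWO-CHANNEL RIGIDITY»), file 5: THE EXPLICIT PRESSURE `p* = Σ_{k≤l} g_k(|z|²)·Δᵏ(Y²)(z)`, ITS POISSON EQUATION, DECAY, UNIQUENESS, AND THE BRACKET (every `l ≥ 2`)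

Prover file (W2 Lean hand ns-crc-p1 g10, by lineage; `--supports stmt-NavierStokesRegularity-27585 --as helper`; objects BY NAME in
`Theorems/UnthreadedRigidityDoorUnthreadedRigidityVirialHornTwoChannelDefs.lean`, p726708 / p728780 and its second append).

Content: `laplacian_radial_mul'` (Δ of radial × homogeneous, non-harmonic version of g9's lemma), Laplacian / bracket of finite sums;
`contDiff_cascadePressure`; ★ `laplacian_cascadePressure`: `Δp* = −Σ_{k≤l} cascadeSrc_k F_k` (the triangular cascade telescopes:
`Δ(g_k F_k) = (4sg_k″ + (4n_k+6)g_k′)F_k + g_k F_{k+1}`); `abs_cascadePressure_le` (`|p*(z)| ≤ C′/|z|`), `tendsto_cascadePressure_sub`;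
★★ `slicePressure_eq_cascadePressure`: every smooth decaying solution of the slice Poisson equation of the degree-`l` shell IS `p* ∘ (· − x₀)`
(Liouville, `ThreadingJets.slicePressure_eq_of_decaying`); ★★ `pbr_slicePressure_eq`:
`{Y, y·∇p₀(x₀+·)}(y) = Σ_{k<l} (2s g_k′ + (2l−2k) g_k)(|y|²)·{Y, F_k}(y)` (the constant top term has no bracket).
HONEST LABEL: slice-level calculus / real analysis about SPECIAL (separable) data; a piece of the L-part of ONE bridge of a RUNG line on the
wall item; `UnthreadedRigidity` (27585), W2 and NS regularity remain OPEN; nothing here is a statement about Navier–Stokes regularity.  0 kit.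
-/

-- the summit and its single sub-problem share the name (CONVENTIONS §1), as in every Theorems file
set_option linter.dupNamespace false

namespace Summit.NavierStokesRegularity.NavierStokesRegularity.Theorems.UnthreadedRigidity.VirialHorn

open scoped RealInnerProductSpace Topology Laplacian
open Filter Set MvPolynomial
open Literature.Combinatorics.LorentzianPolynomials (pderiv_pderiv_comm)
open Summit.NavierStokesRegularity.NavierStokesRegularity.Theorems.UnthreadedRigidity.ProfileHorn (E3)
open Summit.NavierStokesRegularity.NavierStokesRegularity.Theorems.UnthreadedRigidity.HornPressure (radCoeff)
open Summit.NavierStokesRegularity.NavierStokesRegularity.Theorems.PoloidalLiouville.HorizonTower hiding E3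

/-! ## §6 The explicit pressure of the degree-`l` shell: smoothness, Poisson equation, decay, uniqueness, the bracket -/

section Pressure

open scoped ContDiff
open Literature.Analysis.FluidPDE
open Summit.NavierStokesRegularity.NavierStokesRegularity.Theorems.UnthreadedRigidity.HornPressure (sum_coord_mul_fderiv_basisFun)

variable {l : ℕ} {P : MvPolynomial (Fin 3) ℝ} {H h : ℝ → ℝ} {C : ℝ}

/-- LAPLACIAN OF A RADIAL FUNCTION TIMES A HOMOGENEOUS ONE (non-harmonic version of g9's `laplacian_radial_mul`):
`Δ(β(|w|²)S) = (4|z|²β″ + (4L+6)β′)·S + β·ΔS` when `DS(z)·z = L S(z)`. -/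
theorem laplacian_radial_mul' {β : ℝ → ℝ} (hβ : ContDiff ℝ ∞ β) {S : E3 → ℝ} (hS : ContDiff ℝ ∞ S) {L : ℝ}
    (hE : ∀ z : E3, fderiv ℝ S z z = L * S z) (z : E3) :
    (Δ (fun w : E3 => β (‖w‖ ^ 2) * S w)) z =
      (4 * ‖z‖ ^ 2 * deriv (deriv β) (‖z‖ ^ 2) + (4 * L + 6) * deriv β (‖z‖ ^ 2)) * S z + β (‖z‖ ^ 2) * (Δ S) z := by
  have hβd : Differentiable ℝ β := hβ.differentiable (by simp)
  have hβ'c : ContDiff ℝ ∞ (deriv β) := contDiff_deriv_of_contDiff_top hβ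
  have hβ'd : Differentiable ℝ (deriv β) := hβ'c.differentiable (by simp)
  have hR : ContDiff ℝ 2 (fun w : E3 => β (‖w‖ ^ 2)) := (contDiff_radial hβ).of_le (by norm_cast)
  have hS2 : ContDiff ℝ 2 S := hS.of_le (by norm_cast)
  rw [laplacian_mul_eq (EuclideanSpace.basisFun (Fin 3) ℝ) hR hS2 z]
  have hrad : (Δ (fun w : E3 => β (‖w‖ ^ 2))) z = 4 * deriv (deriv β) (‖z‖ ^ 2) * ‖z‖ ^ 2 + 6 * deriv β (‖z‖ ^ 2) := by
    have h := laplacian_comp_norm_sq (E := E3) (g := β) (g₁ := deriv β) (g₂ := deriv (deriv β) (‖z‖ ^ 2)) (z := z)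
      isOpen_univ (fun σ _ => (hβd σ).hasDerivAt) (mem_univ _) ((hβ'd _).hasDerivAt)
    simp only [finrank_euclideanSpace, Fintype.card_fin] at h
    rw [h]
    norm_num
  have hN : HasFDerivAt (fun w : E3 => ‖w‖ ^ 2) (2 • innerSL ℝ z) z := (hasStrictFDerivAt_norm_sq z).hasFDerivAt
  have hfd : ∀ i : Fin 3, fderiv ℝ (fun w : E3 => β (‖w‖ ^ 2)) z (EuclideanSpace.basisFun (Fin 3) ℝ i) =
      2 * deriv β (‖z‖ ^ 2) * z i := by
    intro i
    have hc := (hβd (‖z‖ ^ 2)).hasDerivAt.comp_hasFDerivAt z hN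
    have hc' : HasFDerivAt (fun w : E3 => β (‖w‖ ^ 2)) (deriv β (‖z‖ ^ 2) • (2 • innerSL ℝ z)) z :=
      hc.congr_of_eventuallyEq (Eventually.of_forall fun w => rfl)
    rw [hc'.fderiv, EuclideanSpace.basisFun_apply]
    simp [EuclideanSpace.inner_single_right, two_smul]
    ring
  rw [hrad]
  simp only [hfd]
  have hsum : ∑ i : Fin 3, 2 * deriv β (‖z‖ ^ 2) * z i * fderiv ℝ S z (EuclideanSpace.basisFun (Fin 3) ℝ i) =
      2 * deriv β (‖z‖ ^ 2) * fderiv ℝ S z z := by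
    rw [← sum_coord_mul_fderiv_basisFun, Finset.mul_sum]
    refine Finset.sum_congr rfl fun i _ => by ring
  rw [hsum, hE z]
  ring

/-- the Laplacian of a finite sum of `C²` functions on `E3`. -/
theorem laplacian_finset_sum {ι : Type*} (s : Finset ι) {f : ι → E3 → ℝ} (hf : ∀ i ∈ s, ContDiff ℝ 2 (f i)) (z : E3) :
    (Δ (fun w : E3 => ∑ i ∈ s, f i w)) z = ∑ i ∈ s, (Δ (f i)) z := by
  classical
  induction s using Finset.induction_on with
  | empty =>
    have : (fun w : E3 => ∑ i ∈ (∅ : Finset ι), f i w) = fun _ => (0 : ℝ) := by funext w; simp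
    rw [this, Finset.sum_empty]
    exact congrFun (InnerProductSpace.laplacian_const (E := E3) (c := (0 : ℝ))) z
  | insert a s ha ih =>
    have hfa : ContDiff ℝ 2 (f a) := hf a (Finset.mem_insert_self a s)
    have hfs : ∀ i ∈ s, ContDiff ℝ 2 (f i) := fun i hi => hf i (Finset.mem_insert_of_mem hi)
    have hsum : ContDiff ℝ 2 (fun w : E3 => ∑ i ∈ s, f i w) := ContDiff.sum fun i hi => hfs i hi
    have hfun : (fun w : E3 => ∑ i ∈ insert a s, f i w) = f a + fun w : E3 => ∑ i ∈ s, f i w := by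
      funext w; simp [Finset.sum_insert ha]
    rw [hfun, hfa.contDiffAt.laplacian_add hsum.contDiffAt, ih hfs, Finset.sum_insert ha]

/-- the bracket of a finite sum. -/
theorem pbr_finset_sum {ι : Type*} (s : Finset ι) (Y : E3 → ℝ) {f : ι → E3 → ℝ} {y : E3}
    (hf : ∀ i ∈ s, DifferentiableAt ℝ (f i) y) :
    pbr Y (fun w : E3 => ∑ i ∈ s, f i w) y = ∑ i ∈ s, pbr Y (f i) y := by
  classical
  induction s using Finset.induction_on with
  | empty =>
    simp only [Finset.sum_empty]
    unfold pbr det3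
    have : gradient (fun _ : E3 => (0 : ℝ)) y = 0 := by
      rw [gradient, fderiv_fun_const]; simp
    simp [this]
  | insert a s ha ih =>
    have hfa : DifferentiableAt ℝ (f a) y := hf a (Finset.mem_insert_self a s)
    have hfs : ∀ i ∈ s, DifferentiableAt ℝ (f i) y := fun i hi => hf i (Finset.mem_insert_of_mem hi)
    have hsum : DifferentiableAt ℝ (fun w : E3 => ∑ i ∈ s, f i w) y := DifferentiableAt.fun_sum fun i hi => hfs i hi
    have hfun : (fun w : E3 => ∑ i ∈ insert a s, f i w) = fun w => f a w + ∑ i ∈ s, f i w := by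
      funext w; simp [Finset.sum_insert ha]
    rw [hfun, pbr_add Y hfa hsum, ih hfs, Finset.sum_insert ha]

/-- THE EXPLICIT PRESSURE IS SMOOTH on `E3` (`l ≥ 3`). -/
theorem contDiff_cascadePressure (hl : 2 ≤ l) (hh : ContDiff ℝ ∞ h) (hHh : ∀ r : ℝ, 0 ≤ r → H r = h (r ^ 2))
    (hC : ∀ r : ℝ, 1 ≤ r → r ^ (l + 2) * |H r| ≤ C ∧ r ^ (l + 3) * |deriv H r| ≤ C ∧ r ^ (l + 4) * |deriv (deriv H) r| ≤ C)
    (P : MvPolynomial (Fin 3) ℝ) : ContDiff ℝ ∞ (cascadePressure l h P) := by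
  unfold cascadePressure
  exact ContDiff.sum fun k hk =>
    (contDiff_radial (contDiff_cascadeCoeff (by omega) hh hHh hC (Nat.lt_succ_iff.mp (Finset.mem_range.mp hk)))).mul
      (Zonal.contDiff_evalE _)

/-- the `k`-th term of the explicit pressure is smooth. -/
theorem contDiff_cascadeTerm (hl : 2 ≤ l) (hh : ContDiff ℝ ∞ h) (hHh : ∀ r : ℝ, 0 ≤ r → H r = h (r ^ 2))
    (hC : ∀ r : ℝ, 1 ≤ r → r ^ (l + 2) * |H r| ≤ C ∧ r ^ (l + 3) * |deriv H r| ≤ C ∧ r ^ (l + 4) * |deriv (deriv H) r| ≤ C)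
    (P : MvPolynomial (Fin 3) ℝ) {k : ℕ} (hk : k ≤ l) :
    ContDiff ℝ ∞ (fun w : E3 => cascadeCoeff l h k (‖w‖ ^ 2) * Zonal.evalE (sqLapP P k) w) :=
  (contDiff_radial (contDiff_cascadeCoeff (by omega) hh hHh hC hk)).mul (Zonal.contDiff_evalE _)

/-- the previous level's coefficient (`0` at level `0`). -/
theorem cascadeCoeff_ode (hl : 1 ≤ l) (hh : ContDiff ℝ ∞ h) (hHh : ∀ r : ℝ, 0 ≤ r → H r = h (r ^ 2))
    (hC : ∀ r : ℝ, 1 ≤ r → r ^ (l + 2) * |H r| ≤ C ∧ r ^ (l + 3) * |deriv H r| ≤ C ∧ r ^ (l + 4) * |deriv (deriv H) r| ≤ C)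
    {k : ℕ} (hk : k ≤ l) {s : ℝ} (hs : 0 ≤ s) :
    4 * s * deriv (deriv (cascadeCoeff l h k)) s + (4 * ((2 * l - 2 * k : ℕ) : ℝ) + 6) * deriv (cascadeCoeff l h k) s
      = -(cascadeSrc l h k s + (if k = 0 then 0 else cascadeCoeff l h (k - 1) s)) := by
  rcases k with _ | k
  · rw [if_pos rfl, add_zero, show cascadeSrc l h 0 s = chanY l h s from rfl]
    have h0 := cascadeCoeff_ode_zero hl hh hHh hC hs
    simp only [Nat.mul_zero, Nat.sub_zero]
    exact h0
  · rw [if_neg (Nat.succ_ne_zero k), Nat.add_sub_cancel]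
    exact cascadeCoeff_ode_succ hl hh hHh hC hk hs

/-- ★ THE EXPLICIT PRESSURE SOLVES THE SLICE POISSON EQUATION (centred, cascade form):
`Δp*(z) = −Σ_{k≤l} cascadeSrc_k(|z|²) F_k(z)`. -/
theorem laplacian_cascadePressure (hl : 2 ≤ l) (hP : P.IsHomogeneous l) (hh : ContDiff ℝ ∞ h)
    (hHh : ∀ r : ℝ, 0 ≤ r → H r = h (r ^ 2))
    (hC : ∀ r : ℝ, 1 ≤ r → r ^ (l + 2) * |H r| ≤ C ∧ r ^ (l + 3) * |deriv H r| ≤ C ∧ r ^ (l + 4) * |deriv (deriv H) r| ≤ C)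
    (z : E3) :
    (Δ (cascadePressure l h P)) z = -∑ k ∈ Finset.range (l + 1), cascadeSrc l h k (‖z‖ ^ 2) * Zonal.evalE (sqLapP P k) z := by
  have hl1 : 1 ≤ l := by omega
  set g := cascadeCoeff l h with hg
  set F : ℕ → E3 → ℝ := fun k => Zonal.evalE (sqLapP P k) with hF
  -- termwise Laplacian
  have hterm : ∀ k ∈ Finset.range (l + 1), (Δ (fun w : E3 => g k (‖w‖ ^ 2) * F k w)) z =
      -(cascadeSrc l h k (‖z‖ ^ 2) + (if k = 0 then 0 else g (k - 1) (‖z‖ ^ 2))) * F k z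
        + g k (‖z‖ ^ 2) * F (k + 1) z := by
    intro k hk
    have hkl : k ≤ l := Nat.lt_succ_iff.mp (Finset.mem_range.mp hk)
    rw [laplacian_radial_mul' (contDiff_cascadeCoeff (by omega) hh hHh hC hkl) (Zonal.contDiff_evalE _)
      (L := ((2 * l - 2 * k : ℕ) : ℝ)) (fun w => fderiv_sqLapP_apply_self hP k w) z,
      laplacian_evalE_sqLapP, cascadeCoeff_ode hl1 hh hHh hC hkl (sq_nonneg _)]
  unfold cascadePressure
  rw [laplacian_finset_sum _ (fun k hk => (contDiff_cascadeTerm hl hh hHh hC P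
      (Nat.lt_succ_iff.mp (Finset.mem_range.mp hk))).of_le (by norm_cast)) z,
    Finset.sum_congr rfl hterm, Finset.sum_add_distrib]
  -- telescoping
  have htop : F (l + 1) z = 0 := by
    simp only [hF, sqLapP_succ_self hP]; simp [Zonal.evalE]
  have h1 : ∑ k ∈ Finset.range (l + 1), g k (‖z‖ ^ 2) * F (k + 1) z =
      ∑ k ∈ Finset.range l, g k (‖z‖ ^ 2) * F (k + 1) z := by
    rw [Finset.sum_range_succ, htop, mul_zero, add_zero]
  have h2 : ∑ k ∈ Finset.range (l + 1), -(cascadeSrc l h k (‖z‖ ^ 2) + (if k = 0 then 0 else g (k - 1) (‖z‖ ^ 2))) * F k z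
      = -(∑ k ∈ Finset.range (l + 1), cascadeSrc l h k (‖z‖ ^ 2) * F k z)
        - ∑ k ∈ Finset.range l, g k (‖z‖ ^ 2) * F (k + 1) z := by
    have hsplit : ∑ k ∈ Finset.range (l + 1), (if k = 0 then 0 else g (k - 1) (‖z‖ ^ 2)) * F k z
        = ∑ k ∈ Finset.range l, g k (‖z‖ ^ 2) * F (k + 1) z := by
      rw [Finset.sum_range_succ']
      simp
    rw [← hsplit, ← Finset.sum_neg_distrib, ← Finset.sum_sub_distrib]
    refine Finset.sum_congr rfl fun k _ => by ring
  rw [h1, h2]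
  ring

/-- DECAY OF EACH TERM of the explicit pressure: `|g_k(|z|²) F_k(z)| ≤ c/|z|` for `|z| ≥ 1`, `k ≤ l`. -/
theorem exists_decay_cascadeTerm (hl : 2 ≤ l) (hP : P.IsHomogeneous l) (hh : ContDiff ℝ ∞ h)
    (hHh : ∀ r : ℝ, 0 ≤ r → H r = h (r ^ 2))
    (hC : ∀ r : ℝ, 1 ≤ r → r ^ (l + 2) * |H r| ≤ C ∧ r ^ (l + 3) * |deriv H r| ≤ C ∧ r ^ (l + 4) * |deriv (deriv H) r| ≤ C)
    (k : ℕ) : ∃ c : ℝ, k ≤ l → ∀ z : E3, 1 ≤ ‖z‖ →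
      |cascadeCoeff l h k (‖z‖ ^ 2) * Zonal.evalE (sqLapP P k) z| ≤ c / ‖z‖ := by
  by_cases hkl : k ≤ l
  swap
  · exact ⟨0, fun h => absurd h hkl⟩
  obtain ⟨CF, hCF0, hCF⟩ := exists_bound_evalE_of_isHomogeneous (isHomogeneous_sqLapP hP k)
  rcases Nat.lt_or_ge k l with hlt | hge
  · obtain ⟨-, K, hK⟩ := cascadeCoeff_smooth_decay (by omega) hh hHh hC k (by omega)
    have hK0 : 0 ≤ K := le_trans (abs_nonneg _) (by simpa using hK 1 le_rfl)
    refine ⟨K * CF, fun _ z hz => ?_⟩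
    have hz0 : 0 < ‖z‖ := by linarith
    have hz2 : 1 ≤ ‖z‖ ^ 2 := by nlinarith
    rw [abs_mul]
    have e1 := hK (‖z‖ ^ 2) hz2
    have e2 := hCF z
    rw [← pow_mul] at e1
    calc |cascadeCoeff l h k (‖z‖ ^ 2)| * |Zonal.evalE (sqLapP P k) z|
        ≤ (K / ‖z‖ ^ (2 * (l - k + 1))) * (CF * ‖z‖ ^ (2 * l - 2 * k)) :=
          mul_le_mul e1 e2 (abs_nonneg _) (by positivity)
      _ = K * CF / ‖z‖ ^ 2 := by
          rw [show 2 * (l - k + 1) = (2 * l - 2 * k) + 2 by omega, pow_add]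
          field_simp
      _ ≤ K * CF / ‖z‖ := by
          apply div_le_div_of_nonneg_left (by positivity) hz0
          nlinarith
  · have hkeq : k = l := le_antisymm hkl hge
    subst hkeq
    obtain ⟨-, K, hK⟩ := cascadeCoeff_top (by omega) hh hHh hC
    refine ⟨K * CF, fun _ z hz => ?_⟩
    have hz0 : 0 < ‖z‖ := by linarith
    rw [abs_mul]
    have e1 := hK ‖z‖ hz
    have e2 := hCF z
    rw [show 2 * k - 2 * k = 0 by omega, pow_zero, mul_one] at e2
    have hK0 : 0 ≤ K := by
      have := le_trans (abs_nonneg _) (hK 1 le_rfl)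
      simpa using this
    calc |cascadeCoeff k h k (‖z‖ ^ 2)| * |Zonal.evalE (sqLapP P k) z| ≤ (K / ‖z‖) * CF :=
          mul_le_mul e1 e2 (abs_nonneg _) (by positivity)
      _ = K * CF / ‖z‖ := by ring

/-- ★ DECAY OF THE EXPLICIT PRESSURE: `|p*(z)| ≤ C′/|z|` for `|z| ≥ 1`. -/
theorem abs_cascadePressure_le (hl : 2 ≤ l) (hP : P.IsHomogeneous l) (hh : ContDiff ℝ ∞ h)
    (hHh : ∀ r : ℝ, 0 ≤ r → H r = h (r ^ 2))
    (hC : ∀ r : ℝ, 1 ≤ r → r ^ (l + 2) * |H r| ≤ C ∧ r ^ (l + 3) * |deriv H r| ≤ C ∧ r ^ (l + 4) * |deriv (deriv H) r| ≤ C) :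
    ∃ C' : ℝ, ∀ z : E3, 1 ≤ ‖z‖ → |cascadePressure l h P z| ≤ C' / ‖z‖ := by
  choose c hc using fun k => exists_decay_cascadeTerm hl hP hh hHh hC k
  refine ⟨∑ k ∈ Finset.range (l + 1), c k, fun z hz => ?_⟩
  unfold cascadePressure
  rw [Finset.sum_div]
  refine (Finset.abs_sum_le_sum_abs _ _).trans (Finset.sum_le_sum fun k hk => ?_)
  exact hc k (Nat.lt_succ_iff.mp (Finset.mem_range.mp hk)) z hz

/-- the translated explicit pressure tends to zero at infinity. -/
theorem tendsto_cascadePressure_sub (hl : 2 ≤ l) (hP : P.IsHomogeneous l) (hh : ContDiff ℝ ∞ h)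
    (hHh : ∀ r : ℝ, 0 ≤ r → H r = h (r ^ 2))
    (hC : ∀ r : ℝ, 1 ≤ r → r ^ (l + 2) * |H r| ≤ C ∧ r ^ (l + 3) * |deriv H r| ≤ C ∧ r ^ (l + 4) * |deriv (deriv H) r| ≤ C)
    (x₀ : E3) :
    Tendsto (fun x : E3 => cascadePressure l h P (x - x₀)) (cocompact E3) (𝓝 0) := by
  obtain ⟨C', hC'⟩ := abs_cascadePressure_le hl hP hh hHh hC
  have hnorm : Tendsto (fun x : E3 => ‖x - x₀‖) (cocompact E3) atTop := by
    have h1 : Tendsto (fun x : E3 => ‖x‖ + -‖x₀‖) (cocompact E3) atTop :=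
      tendsto_atTop_add_const_right _ _ tendsto_norm_cocompact_atTop
    refine tendsto_atTop_mono (fun x => ?_) h1
    have := norm_sub_norm_le x x₀
    linarith
  have hb : Tendsto (fun x : E3 => C' / ‖x - x₀‖) (cocompact E3) (𝓝 0) := tendsto_const_nhds.div_atTop hnorm
  refine squeeze_zero_norm' ?_ hb
  filter_upwards [hnorm.eventually (eventually_ge_atTop 1)] with x hx
  rw [Real.norm_eq_abs]
  exact hC' (x - x₀) hx

/-- ★★ THE SLICE PRESSURE IS THE EXPLICIT PRESSURE: for the degree-`l` shell `u₀ = sepShellL H (evalE P) x₀` (virial-admissible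
`H`, `l ≥ 3`) every smooth decaying solution of `Δp₀ = −div((u₀·∇)u₀)` is `p₀ = p* ∘ (· − x₀)` (Liouville,
`ThreadingJets.slicePressure_eq_of_decaying`). -/
theorem slicePressure_eq_cascadePressure (hl : 2 ≤ l) (hP : P.IsHomogeneous l) (hlap : Zonal.lapP P = 0)
    (hh : ContDiff ℝ ∞ h) (hHh : ∀ r : ℝ, 0 ≤ r → H r = h (r ^ 2))
    (hC : ∀ r : ℝ, 1 ≤ r → r ^ (l + 2) * |H r| ≤ C ∧ r ^ (l + 3) * |deriv H r| ≤ C ∧ r ^ (l + 4) * |deriv (deriv H) r| ≤ C)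
    (x₀ : E3) (hsm : ContDiff ℝ (⊤ : ℕ∞) (sepShellL H (Zonal.evalE P) x₀))
    (hdiv : VectorCalculus.IsDivFree (sepShellL H (Zonal.evalE P) x₀))
    {p₀ : E3 → ℝ} (hp : ContDiff ℝ (⊤ : ℕ∞) p₀)
    (hpoi : ∀ x : E3, (Δ p₀) x =
      -VectorCalculus.divergence (convect (sepShellL H (Zonal.evalE P) x₀) (sepShellL H (Zonal.evalE P) x₀)) x)
    (hdec : Tendsto p₀ (cocompact E3) (𝓝 0)) :
    p₀ = fun x : E3 => cascadePressure l h P (x - x₀) := by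
  refine ThreadingJets.slicePressure_eq_of_decaying hp hpoi hdec ?_ ?_ (tendsto_cascadePressure_sub hl hP hh hHh hC x₀)
  · exact ((contDiff_cascadePressure hl hh hHh hC P).of_le (by norm_cast)).comp (contDiff_id.sub contDiff_const)
  · intro x
    have hsrc := divergence_convect_sepShellL_cascade (by omega) hP hlap hh hHh x₀ hsm hdiv (x - x₀)
    rw [add_sub_cancel] at hsrc
    rw [laplacian_comp_sub_const (cascadePressure l h P) x₀ x, laplacian_cascadePressure hl hP hh hHh hC (x - x₀), hsrc]

/-- the radial pairing `⟪z, ∇p*(z)⟫` of the explicit pressure: `Σ_k (2|z|² g_k′(|z|²) + (2l−2k) g_k(|z|²)) F_k(z)`. -/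
theorem inner_gradient_cascadePressure (hl : 2 ≤ l) (hP : P.IsHomogeneous l) (hh : ContDiff ℝ ∞ h)
    (hHh : ∀ r : ℝ, 0 ≤ r → H r = h (r ^ 2))
    (hC : ∀ r : ℝ, 1 ≤ r → r ^ (l + 2) * |H r| ≤ C ∧ r ^ (l + 3) * |deriv H r| ≤ C ∧ r ^ (l + 4) * |deriv (deriv H) r| ≤ C)
    (z : E3) :
    ⟪z, gradient (cascadePressure l h P) z⟫ =
      ∑ k ∈ Finset.range (l + 1), (2 * ‖z‖ ^ 2 * deriv (cascadeCoeff l h k) (‖z‖ ^ 2)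
        + ((2 * l - 2 * k : ℕ) : ℝ) * cascadeCoeff l h k (‖z‖ ^ 2)) * Zonal.evalE (sqLapP P k) z := by
  rw [real_inner_comm, inner_gradient_left]
  have hdiff : ∀ k ∈ Finset.range (l + 1), DifferentiableAt ℝ
      (fun w : E3 => cascadeCoeff l h k (‖w‖ ^ 2) * Zonal.evalE (sqLapP P k) w) z := fun k hk =>
    ((contDiff_cascadeTerm hl hh hHh hC P (Nat.lt_succ_iff.mp (Finset.mem_range.mp hk))).differentiable (by simp)) z
  have hfun : cascadePressure l h P = fun w => ∑ k ∈ Finset.range (l + 1),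
      cascadeCoeff l h k (‖w‖ ^ 2) * Zonal.evalE (sqLapP P k) w := rfl
  rw [hfun, fderiv_fun_sum hdiff, FunLike.coe_sum, Finset.sum_apply]
  refine Finset.sum_congr rfl fun k hk => ?_
  have hkl : k ≤ l := Nat.lt_succ_iff.mp (Finset.mem_range.mp hk)
  have hgd : Differentiable ℝ (cascadeCoeff l h k) := (contDiff_cascadeCoeff (by omega) hh hHh hC hkl).differentiable (by simp)
  have hR : DifferentiableAt ℝ (fun w : E3 => cascadeCoeff l h k (‖w‖ ^ 2)) z := differentiableAt_radial hgd z
  have hFd : DifferentiableAt ℝ (Zonal.evalE (sqLapP P k)) z := Zonal.differentiable_evalE _ z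
  rw [fderiv_fun_mul hR hFd]
  simp only [FunLike.coe_add, FunLike.coe_smul, Pi.add_apply, Pi.smul_apply, smul_eq_mul,
    fderiv_radial_apply_self hgd z, fderiv_sqLapP_apply_self hP k z]
  ring

/-- the constant top term has no bracket: `{Y, F_l} = 0`. -/
theorem pbr_sqLapP_top (hP : P.IsHomogeneous l) (Y : E3 → ℝ) (y : E3) : pbr Y (Zonal.evalE (sqLapP P l)) y = 0 := by
  have h0 : (sqLapP P l).IsHomogeneous 0 := by simpa using isHomogeneous_sqLapP hP l
  rw [← totalDegree_zero_iff_isHomogeneous, totalDegree_eq_zero_iff_eq_C] at h0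
  have hconst : Zonal.evalE (sqLapP P l) = fun _ : E3 => coeff 0 (sqLapP P l) := by
    rw [h0]; funext y; simp [Zonal.evalE]
  unfold pbr det3
  rw [hconst]
  have : gradient (fun _ : E3 => coeff 0 (sqLapP P l)) y = 0 := by rw [gradient, fderiv_fun_const]; simp
  simp [this]

/-- ★★ THE PRESSURE BRACKET IN THE CASCADE BASIS: for the decaying slice pressure `p₀` of the degree-`l` shell about `x₀`,
`{Y, y·∇p₀(x₀+·)}(y) = Σ_{k<l} e_k(|y|²)·{Y, F_k}(y)` with the Euler coefficients `e_k = 2s g_k′ + (2l−2k) g_k`. -/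
theorem pbr_slicePressure_eq (hl : 2 ≤ l) (hP : P.IsHomogeneous l) (hlap : Zonal.lapP P = 0)
    (hh : ContDiff ℝ ∞ h) (hHh : ∀ r : ℝ, 0 ≤ r → H r = h (r ^ 2))
    (hC : ∀ r : ℝ, 1 ≤ r → r ^ (l + 2) * |H r| ≤ C ∧ r ^ (l + 3) * |deriv H r| ≤ C ∧ r ^ (l + 4) * |deriv (deriv H) r| ≤ C)
    (x₀ : E3) (hsm : ContDiff ℝ (⊤ : ℕ∞) (sepShellL H (Zonal.evalE P) x₀))
    (hdiv : VectorCalculus.IsDivFree (sepShellL H (Zonal.evalE P) x₀))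
    {p₀ : E3 → ℝ} (hp : ContDiff ℝ (⊤ : ℕ∞) p₀)
    (hpoi : ∀ x : E3, (Δ p₀) x =
      -VectorCalculus.divergence (convect (sepShellL H (Zonal.evalE P) x₀) (sepShellL H (Zonal.evalE P) x₀)) x)
    (hdec : Tendsto p₀ (cocompact E3) (𝓝 0)) (y : E3) :
    pbr (Zonal.evalE P) (fun z : E3 => ⟪z, gradient p₀ (x₀ + z)⟫) y =
      ∑ k ∈ Finset.range l, (2 * ‖y‖ ^ 2 * deriv (cascadeCoeff l h k) (‖y‖ ^ 2)
        + ((2 * l - 2 * k : ℕ) : ℝ) * cascadeCoeff l h k (‖y‖ ^ 2)) * pbr (Zonal.evalE P) (sqLapF (Zonal.evalE P) k) y := by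
  have hp0 := slicePressure_eq_cascadePressure hl hP hlap hh hHh hC x₀ hsm hdiv hp hpoi hdec
  -- the paired function, explicitly
  have hfun : (fun z : E3 => ⟪z, gradient p₀ (x₀ + z)⟫) = fun z => ∑ k ∈ Finset.range (l + 1),
      (2 * ‖z‖ ^ 2 * deriv (cascadeCoeff l h k) (‖z‖ ^ 2) + ((2 * l - 2 * k : ℕ) : ℝ) * cascadeCoeff l h k (‖z‖ ^ 2))
        * Zonal.evalE (sqLapP P k) z := by
    funext z
    rw [hp0, gradient_comp_sub_const (cascadePressure l h P) x₀ (x₀ + z), add_sub_cancel_left]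
    exact inner_gradient_cascadePressure hl hP hh hHh hC z
  rw [hfun]
  have hcoef : ∀ k ∈ Finset.range (l + 1), Differentiable ℝ (fun s : ℝ =>
      2 * s * deriv (cascadeCoeff l h k) s + ((2 * l - 2 * k : ℕ) : ℝ) * cascadeCoeff l h k s) := by
    intro k hk
    have hkl : k ≤ l := Nat.lt_succ_iff.mp (Finset.mem_range.mp hk)
    have hc := contDiff_cascadeCoeff (by omega) hh hHh hC hkl
    have hd : Differentiable ℝ (deriv (cascadeCoeff l h k)) := (contDiff_deriv_of_contDiff_top hc).differentiable (by simp)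
    exact ((differentiable_const _ |>.mul differentiable_id).mul hd).add ((differentiable_const _).mul (hc.differentiable (by simp)))
  rw [pbr_finset_sum (Finset.range (l + 1)) (Zonal.evalE P)
    (f := fun k w => (2 * ‖w‖ ^ 2 * deriv (cascadeCoeff l h k) (‖w‖ ^ 2)
      + ((2 * l - 2 * k : ℕ) : ℝ) * cascadeCoeff l h k (‖w‖ ^ 2)) * Zonal.evalE (sqLapP P k) w)
    (fun k hk => (differentiableAt_radial (hcoef k hk) y).mul (Zonal.differentiable_evalE _ y))]
  rw [Finset.sum_range_succ]
  have hlast : pbr (Zonal.evalE P) (fun w : E3 => (2 * ‖w‖ ^ 2 * deriv (cascadeCoeff l h l) (‖w‖ ^ 2)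
      + ((2 * l - 2 * l : ℕ) : ℝ) * cascadeCoeff l h l (‖w‖ ^ 2)) * Zonal.evalE (sqLapP P l) w) y = 0 := by
    rw [pbr_radial_mul (hcoef l (Finset.self_mem_range_succ l)) _ (Zonal.differentiable_evalE _ y), pbr_sqLapP_top hP, mul_zero]
  rw [hlast, add_zero]
  refine Finset.sum_congr rfl fun k hk => ?_
  rw [pbr_radial_mul (hcoef k (Finset.mem_range.mpr (by have := Finset.mem_range.mp hk; omega))) _
    (Zonal.differentiable_evalE _ y), sqLapF_evalE]

end Pressure

end Summit.NavierStokesRegularity.NavierStokesRegularity.Theorems.UnthreadedRigidity.VirialHorn
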